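import Literature.Topology.FourManifolds.TautFoliationsContourSquareFloor
import Mathlib.Data.ZMod.Basic
import HarnessLib

/-!
# The four sectors at a vertex of the square grid: plane geometry

Topic: the local model of the contour foliation of a disc in checkerboard cone position at an
interior vertex `v` (mesh `ℓ`, max norm). The four **sectors** at `v` are the closed right-angled
cones around the four half edges issuing from `v`, bounded by the diagonals of the four squares
at `v`; the sector `j : ℤ/4` is the image under the `j`-th quarter turn about `v` of the
standard sector `{|w₂| ≤ w₁}` (coordinates `w = z - v`). Each sector is swept by the **broken
rays** through the points of its half edge from the centres of its two squares (the rays of the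
cone construction), and we record the explicit parametrisation
`(b, u) ↦ v + Rʲ (b + |u| (ℓ - b) / ℓ, s u)` (`b` = abscissa of the edge point of the broken
ray, `u` = signed ordinate, `s = ±1` a sign), its inverse coordinates, and the max-norm facts
(distance to the two centres, radial projection = the edge point) that turn the cone heights of
the two squares into affine functions of `u` along each broken ray.

* `VertexSector.R`, `VertexSector.Rz` (**definitions**: the quarter turn and its powers, linear,
  max-norm preserving), `VertexSector.spt`, `VertexSector.stdc`, `VertexSector.bco`
  (**definitions**);
* `VertexSector.bco_spt`, `VertexSector.stdc_spt`, `VertexSector.spt_bco` (**proved**: the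
  coordinates invert the parametrisation on the sector);
* `VertexSector.dist_spt_upper`, `VertexSector.proj_spt_upper` (and `lower`) (**proved**: on the
  upper half of the sector the distance to the centre `v + Rʲ(ℓ, ℓ)` is `ℓ - |u|` and the radial
  projection is the edge point `v + Rʲ (b, 0)`; symmetrically on the lower half);
* `VertexSector.coneHt_spt_upper` / `_lower` (**proved**): the cone height along a broken ray is
  `ψ(e_b) + (m - ψ(e_b)) |u| / ℓ`.

All statements are [folklore] (elementary plane geometry in the max norm).
-/

noncomputable section

open Set Metric Function

namespace Literature.Topology.FourManifolds

namespace VertexSector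

/-! ## Quarter turns -/

/-- The quarter turn (counterclockwise) about the origin, as a linear map. [folklore] -/
def R : (ℝ × ℝ) →ₗ[ℝ] (ℝ × ℝ) where
  toFun w := (-w.2, w.1)
  map_add' w w' := by ext <;> simp; ring
  map_smul' t w := by ext <;> simp

/-- The formula for `R`. [folklore] -/
@[simp] theorem R_apply (w : ℝ × ℝ) : R w = (-w.2, w.1) := rfl

/-- `R` preserves the max norm. [folklore] -/
@[simp] theorem norm_R (w : ℝ × ℝ) : ‖R w‖ = ‖w‖ := by
  rw [R_apply, Prod.norm_mk, Prod.norm_def, norm_neg, max_comm]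

/-- `R⁴ = 1`. [folklore] -/
theorem R_pow_four : R ^ 4 = 1 := by
  refine LinearMap.ext fun w ↦ ?_
  simp [pow_succ, Module.End.mul_apply]

/-- Powers of `R` only depend on the exponent modulo `4`. [folklore] -/
theorem R_pow_mod (n : ℕ) : R ^ (n % 4) = R ^ n := by
  conv_rhs => rw [← Nat.mod_add_div n 4, pow_add, pow_mul, R_pow_four, one_pow, mul_one]

/-- The powers of the quarter turn, indexed by `ℤ/4`. [folklore] -/
def Rz (j : ZMod 4) : (ℝ × ℝ) →ₗ[ℝ] (ℝ × ℝ) := R ^ j.val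

/-- `Rz` is a homomorphism. [folklore] -/
theorem Rz_add (i j : ZMod 4) : Rz (i + j) = Rz i * Rz j := by
  unfold Rz
  rw [ZMod.val_add, R_pow_mod, pow_add]

/-- `Rz 0 = 1`. [folklore] -/
@[simp] theorem Rz_zero_eq : Rz 0 = 1 := by simp [Rz]

/-- `Rz 0` is the identity. [folklore] -/
theorem Rz_zero (w : ℝ × ℝ) : Rz 0 w = w := by simp

/-- `Rz 1 = R`. [folklore] -/
@[simp] theorem Rz_one_eq : Rz 1 = R := by
  simp [Rz, show (1 : ZMod 4).val = 1 from rfl]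

/-- Powers of `R` preserve the max norm. [folklore] -/
theorem norm_R_pow (k : ℕ) (w : ℝ × ℝ) : ‖(R ^ k) w‖ = ‖w‖ := by
  induction k with
  | zero => simp
  | succ k ih => rw [pow_succ', Module.End.mul_apply, norm_R, ih]

/-- `Rz j` preserves the max norm. [folklore] -/
@[simp] theorem norm_Rz (j : ZMod 4) (w : ℝ × ℝ) : ‖Rz j w‖ = ‖w‖ := norm_R_pow _ w

/-- `Rz j` preserves distances. [folklore] -/
@[simp] theorem dist_Rz (j : ZMod 4) (w w' : ℝ × ℝ) : dist (Rz j w) (Rz j w') = dist w w' := by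
  rw [dist_eq_norm, dist_eq_norm, ← map_sub, norm_Rz]

/-- `Rz (j + 1) = R ∘ Rz j`. [folklore] -/
theorem Rz_add_one (j : ZMod 4) (w : ℝ × ℝ) : Rz (j + 1) w = R (Rz j w) := by
  rw [add_comm, Rz_add, Rz_one_eq, Module.End.mul_apply]

/-- The value of `Rz 1`. [folklore] -/
theorem Rz_one (w : ℝ × ℝ) : Rz 1 w = (-w.2, w.1) := by rw [Rz_one_eq, R_apply]

/-- The value of `Rz 2`. [folklore] -/
theorem Rz_two (w : ℝ × ℝ) : Rz 2 w = (-w.1, -w.2) := by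
  rw [show (2 : ZMod 4) = 1 + 1 from rfl, Rz_add_one, Rz_one, R_apply]

/-- The value of `Rz 3`. [folklore] -/
theorem Rz_three (w : ℝ × ℝ) : Rz 3 w = (w.2, -w.1) := by
  rw [show (3 : ZMod 4) = 2 + 1 from rfl, Rz_add_one, Rz_two, R_apply]
  simp

/-- `R` commutes with `Rz j`. [folklore] -/
theorem R_Rz_comm (j : ZMod 4) (w : ℝ × ℝ) : R (Rz j w) = Rz j (R w) := by
  have h : Rz (1 + j) = Rz (j + 1) := by rw [add_comm]
  rw [Rz_add, Rz_add, Rz_one_eq] at h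
  exact (LinearMap.congr_fun h w)

/-- `Rz (-j)` inverts `Rz j`. [folklore] -/
@[simp] theorem Rz_neg_Rz (j : ZMod 4) (w : ℝ × ℝ) : Rz (-j) (Rz j w) = w := by
  rw [← Module.End.mul_apply, ← Rz_add, neg_add_cancel, Rz_zero]

/-- `Rz j` inverts `Rz (-j)`. [folklore] -/
@[simp] theorem Rz_Rz_neg (j : ZMod 4) (w : ℝ × ℝ) : Rz j (Rz (-j) w) = w := by
  rw [← Module.End.mul_apply, ← Rz_add, add_neg_cancel, Rz_zero]

/-- `Rz j` is injective. [folklore] -/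
theorem Rz_injective (j : ZMod 4) : Injective (Rz j) := fun w w' h ↦ by
  rw [← Rz_neg_Rz j w, ← Rz_neg_Rz j w', h]

/-- Powers of `R` are continuous. [folklore] -/
theorem continuous_R_pow (k : ℕ) : Continuous (R ^ k) := by
  induction k with
  | zero => rw [pow_zero, Module.End.one_eq_id]; exact continuous_id
  | succ k ih =>
    have hR : Continuous R := by
      show Continuous fun w : ℝ × ℝ ↦ (-w.2, w.1)
      fun_prop
    rw [pow_succ']
    exact hR.comp ih

/-- `Rz` is continuous. [folklore] -/
theorem continuous_Rz (j : ZMod 4) : Continuous (Rz j) := continuous_R_pow _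

/-! ## The parametrisation of the sectors -/

variable (v : ℝ × ℝ) (ℓ : ℝ)

/-- The standard point of abscissa-of-edge-point `b` and ordinate `u`: on the broken ray through
the edge point `(b, 0)`. [folklore] -/
def stdPt (p : ℝ × ℝ) : ℝ × ℝ := (p.1 + |p.2| * (ℓ - p.1) / ℓ, p.2)

/-- **The parametrisation of the sector `j` with sign `s`.** [folklore] -/
def spt (j : ZMod 4) (s : ℝ) (p : ℝ × ℝ) : ℝ × ℝ := v + Rz j (stdPt ℓ (p.1, s * p.2))

/-- The standard coordinates of a point, for the sector `j`. [folklore] -/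
def stdc (j : ZMod 4) (z : ℝ × ℝ) : ℝ × ℝ := Rz (-j) (z - v)

/-- The abscissa of the edge point of the broken ray through a standard point. [folklore] -/
def bst (w : ℝ × ℝ) : ℝ := ℓ * (w.1 - |w.2|) / (ℓ - |w.2|)

/-- **The `b`-coordinate** of a point, for the sector `j`. [folklore] -/
def bco (j : ZMod 4) (z : ℝ × ℝ) : ℝ := bst ℓ (stdc v j z)

/-- The (unsigned) `u`-coordinate of a point, for the sector `j`. [folklore] -/
def uco (j : ZMod 4) (z : ℝ × ℝ) : ℝ := (stdc v j z).2

variable {v ℓ}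

/-- A sign. [folklore] -/
def IsSg (s : ℝ) : Prop := s = 1 ∨ s = -1

/-- A sign squares to `1`. [folklore] -/
theorem IsSg.mul_self {s : ℝ} (h : IsSg s) : s * s = 1 := by rcases h with rfl | rfl <;> norm_num

/-- Multiplying by a sign does not change the absolute value. [folklore] -/
theorem IsSg.abs_mul {s : ℝ} (h : IsSg s) (u : ℝ) : |s * u| = |u| := by
  rcases h with rfl | rfl <;> simp

/-- The standard coordinates of the parametrised point. [folklore] -/
@[simp] theorem stdc_spt (j : ZMod 4) (s : ℝ) (p : ℝ × ℝ) : stdc v j (spt v ℓ j s p) = stdPt ℓ (p.1, s * p.2) := by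
  simp [stdc, spt]

/-- The `b`-coordinate of a standard point. [folklore] -/
theorem bst_stdPt (hℓ : 0 < ℓ) {p : ℝ × ℝ} (hu : |p.2| < ℓ) : bst ℓ (stdPt ℓ p) = p.1 := by
  simp only [bst, stdPt]
  have hne : ℓ - |p.2| ≠ 0 := by linarith
  field_simp
  ring

/-- **The `b`-coordinate of the parametrised point.** [folklore] -/
theorem bco_spt (hℓ : 0 < ℓ) (j : ZMod 4) {s : ℝ} (hs : IsSg s) {p : ℝ × ℝ} (hu : |p.2| < ℓ) :
    bco v ℓ j (spt v ℓ j s p) = p.1 := by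
  rw [bco, stdc_spt, bst_stdPt hℓ (by simpa [hs.abs_mul] using hu)]

/-- The `u`-coordinate of the parametrised point. [folklore] -/
theorem uco_spt (j : ZMod 4) (s : ℝ) (p : ℝ × ℝ) : uco v j (spt v ℓ j s p) = s * p.2 := by
  rw [uco, stdc_spt]; rfl

/-- **The parametrisation is injective** on `|u| < ℓ`, for a sign `s`. [folklore] -/
theorem spt_injOn (hℓ : 0 < ℓ) (j : ZMod 4) {s : ℝ} (hs : IsSg s) :
    InjOn (spt v ℓ j s) {p | |p.2| < ℓ} := by
  intro p hp p' hp' h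
  have hb : p.1 = p'.1 := by rw [← bco_spt hℓ j hs hp, ← bco_spt hℓ j hs hp', h]
  have hu : s * p.2 = s * p'.2 := by rw [← uco_spt (v := v) (ℓ := ℓ) j s p, ← uco_spt (v := v) (ℓ := ℓ) j s p', h]
  have hu' : p.2 = p'.2 := by
    have := congrArg (s * ·) hu
    simpa [← mul_assoc, hs.mul_self] using this
  exact Prod.ext hb hu'

/-- **The coordinates invert the parametrisation on the sector**: a point whose standard
coordinates satisfy `|w₂| ≤ w₁`, `|w₂| < ℓ` is the parametrised point of `(bco, s · uco)`.
[folklore] -/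
theorem spt_bco (hℓ : 0 < ℓ) (j : ZMod 4) {s : ℝ} (hs : IsSg s) {z : ℝ × ℝ}
    (hu : |(stdc v j z).2| < ℓ) :
    spt v ℓ j s (bco v ℓ j z, s * uco v j z) = z := by
  have hsw : s * (s * (stdc v j z).2) = (stdc v j z).2 := by rw [← mul_assoc, hs.mul_self, one_mul]
  have key : stdPt ℓ (bst ℓ (stdc v j z), (stdc v j z).2) = stdc v j z := by
    set w := stdc v j z with hw
    simp only [stdPt, bst]
    have hne : ℓ - |w.2| ≠ 0 := by linarith
    ext
    · simp only
      field_simp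
      ring
    · rfl
  unfold spt
  simp only [uco, bco, hsw]
  rw [key, stdc, Rz_Rz_neg, add_sub_cancel]

/-- The parametrisation is continuous. [folklore] -/
theorem continuous_spt (hℓ : 0 < ℓ) (j : ZMod 4) (s : ℝ) : Continuous (spt v ℓ j s) := by
  unfold spt stdPt
  refine continuous_const.add ((continuous_Rz j).comp ?_)
  have hℓ0 : ℓ ≠ 0 := hℓ.ne'
  fun_prop

/-- The standard coordinates are continuous. [folklore] -/
theorem continuous_stdc (j : ZMod 4) : Continuous (stdc v j) := by
  unfold stdc; exact (continuous_Rz (-j)).comp (continuous_id.sub continuous_const)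

/-- The `b`-coordinate is continuous where `|u| < ℓ`. [folklore] -/
theorem continuousOn_bco (j : ZMod 4) : ContinuousOn (bco v ℓ j) {z | |(stdc v j z).2| < ℓ} := by
  unfold bco bst
  refine ContinuousOn.div ?_ ?_ fun z hz ↦ by simp only [mem_setOf_eq] at hz; linarith
  · exact ((continuous_const.mul ((continuous_fst.sub (continuous_abs.comp continuous_snd)))).comp
      (continuous_stdc j)).continuousOn
  · exact ((continuous_const.sub (continuous_abs.comp continuous_snd)).comp (continuous_stdc j)).continuousOn

/-- `spt` at `v`: the parameter `(0, 0)`. [folklore] -/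
@[simp] theorem spt_zero (j : ZMod 4) (s : ℝ) : spt v ℓ j s 0 = v := by
  simp [spt, stdPt, Prod.mk_zero_zero]

/-! ## Distances and projections: the two squares of a sector -/

/-- The centre of the **upper square** of the sector `j`. [folklore] -/
def cU (v : ℝ × ℝ) (ℓ : ℝ) (j : ZMod 4) : ℝ × ℝ := v + Rz j (ℓ, ℓ)

/-- The centre of the **lower square** of the sector `j`. [folklore] -/
def cL (v : ℝ × ℝ) (ℓ : ℝ) (j : ZMod 4) : ℝ × ℝ := v + Rz j (ℓ, -ℓ)

/-- The edge point of abscissa `b` of the sector `j`. [folklore] -/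
def ept (v : ℝ × ℝ) (j : ZMod 4) (b : ℝ) : ℝ × ℝ := v + Rz j (b, 0)

/-- Distances from `v + Rz j w` to `v + Rz j c` are standard distances. [folklore] -/
theorem dist_vadd_Rz (j : ZMod 4) (w c : ℝ × ℝ) : dist (v + Rz j w) (v + Rz j c) = dist w c := by
  rw [dist_eq_norm, show v + Rz j w - (v + Rz j c) = Rz j w - Rz j c by abel, ← dist_eq_norm, dist_Rz]

/-- **Max-norm distance of an upper standard point to `(ℓ, ℓ)`**: `ℓ - u` when
`0 ≤ u ≤ w₁ ≤ ℓ`... precisely for `w = stdPt (b, u)` with `0 ≤ b ≤ ℓ`, `0 ≤ u < ℓ`. [folklore] -/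
theorem dist_stdPt_upper (hℓ : 0 < ℓ) {b u : ℝ} (hb : b ∈ Icc 0 ℓ) (hu : u ∈ Ico 0 ℓ) :
    dist (stdPt ℓ (b, u)) (ℓ, ℓ) = ℓ - u := by
  rw [Prod.dist_eq, stdPt, Real.dist_eq, Real.dist_eq]
  simp only [abs_of_nonneg hu.1]
  have h1 : b + u * (ℓ - b) / ℓ - ℓ = -((ℓ - u) * (ℓ - b) / ℓ) := by field_simp; ring
  have hnn : 0 ≤ (ℓ - u) * (ℓ - b) / ℓ := div_nonneg (mul_nonneg (by linarith [hu.2]) (by linarith [hb.2])) hℓ.le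
  have hle : (ℓ - u) * (ℓ - b) / ℓ ≤ ℓ - u := by
    rw [div_le_iff₀ hℓ]; nlinarith [hb.1, hu.2]
  rw [h1, abs_neg, abs_of_nonneg hnn, show u - ℓ = -(ℓ - u) by ring, abs_neg, abs_of_nonneg (by linarith [hu.2])]
  exact max_eq_right hle

/-- **Max-norm distance of a lower standard point to `(ℓ, -ℓ)`**: `ℓ - |u|` for `u ≤ 0`.
[folklore] -/
theorem dist_stdPt_lower (hℓ : 0 < ℓ) {b u : ℝ} (hb : b ∈ Icc 0 ℓ) (hu : u ∈ Ioc (-ℓ) 0) :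
    dist (stdPt ℓ (b, u)) (ℓ, -ℓ) = ℓ + u := by
  rw [Prod.dist_eq, stdPt, Real.dist_eq, Real.dist_eq]
  simp only [abs_of_nonpos hu.2]
  have h1 : b + -u * (ℓ - b) / ℓ - ℓ = -((ℓ + u) * (ℓ - b) / ℓ) := by field_simp; ring
  have hnn : 0 ≤ (ℓ + u) * (ℓ - b) / ℓ := div_nonneg (mul_nonneg (by linarith [hu.1]) (by linarith [hb.2])) hℓ.le
  have hle : (ℓ + u) * (ℓ - b) / ℓ ≤ ℓ + u := by
    rw [div_le_iff₀ hℓ]; nlinarith [hb.1, hu.1]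
  rw [h1, abs_neg, abs_of_nonneg hnn, show u - -ℓ = ℓ + u by ring, abs_of_nonneg (by linarith [hu.1])]
  exact max_eq_right hle

/-- The radial projection from `v + Rz j c` of `v + Rz j w`. [folklore] -/
theorem proj_vadd_Rz (j : ZMod 4) {w c : ℝ × ℝ} (hw : w ≠ c) :
    ConeSquare.proj (v + Rz j c) ℓ (v + Rz j w) = v + Rz j (ConeSquare.proj c ℓ w) := by
  have hw' : v + Rz j w ≠ v + Rz j c := fun h ↦ hw (Rz_injective j (add_left_cancel h))
  rw [ConeSquare.proj_of_ne hw', ConeSquare.proj_of_ne hw, dist_vadd_Rz,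
    show v + Rz j w - (v + Rz j c) = Rz j (w - c) by rw [map_sub]; abel, ← map_smul, map_add, add_assoc]

/-- The radial coordinate about `v + Rz j c` of `v + Rz j w`. [folklore] -/
theorem radial_vadd_Rz (j : ZMod 4) (w c : ℝ × ℝ) :
    ConeSquare.radial (v + Rz j c) ℓ (v + Rz j w) = ConeSquare.radial c ℓ w := by
  rw [ConeSquare.radial_def, ConeSquare.radial_def, dist_vadd_Rz]

/-- **The standard projection of an upper standard point from `(ℓ, ℓ)` is the edge point `(b, 0)`.**
[folklore] -/
theorem proj_stdPt_upper (hℓ : 0 < ℓ) {b u : ℝ} (hb : b ∈ Icc 0 ℓ) (hu : u ∈ Ico 0 ℓ) :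
    ConeSquare.proj (ℓ, ℓ) ℓ (stdPt ℓ (b, u)) = (b, 0) := by
  have hne : stdPt ℓ (b, u) ≠ (ℓ, ℓ) := fun h ↦ by
    have := congrArg Prod.snd h; simp [stdPt] at this; linarith [hu.2]
  rw [ConeSquare.proj_of_ne hne, dist_stdPt_upper hℓ hb hu]
  have hlu : ℓ - u ≠ 0 := by linarith [hu.2]
  ext <;> simp [stdPt, abs_of_nonneg hu.1] <;> field_simp <;> ring

/-- **The standard projection of a lower standard point from `(ℓ, -ℓ)` is the edge point.**
[folklore] -/
theorem proj_stdPt_lower (hℓ : 0 < ℓ) {b u : ℝ} (hb : b ∈ Icc 0 ℓ) (hu : u ∈ Ioc (-ℓ) 0) :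
    ConeSquare.proj (ℓ, -ℓ) ℓ (stdPt ℓ (b, u)) = (b, 0) := by
  have hne : stdPt ℓ (b, u) ≠ (ℓ, -ℓ) := fun h ↦ by
    have := congrArg Prod.snd h; simp [stdPt] at this; linarith [hu.1]
  rw [ConeSquare.proj_of_ne hne, dist_stdPt_lower hℓ hb hu]
  have hlu : ℓ + u ≠ 0 := by linarith [hu.1]
  ext <;> simp [stdPt, abs_of_nonpos hu.2] <;> field_simp <;> ring

/-- **The cone height of the upper square along a broken ray**: for the point of parameters
`(b, u)`, `0 ≤ s u < ℓ` (upper side), it is `ψ(e_b) + (m - ψ(e_b)) (s u) / ℓ`. [folklore] -/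
theorem coneHt_spt_upper (hℓ : 0 < ℓ) (j : ZMod 4) {s : ℝ} (m : ℝ) (ψ : ℝ × ℝ → ℝ) {b u : ℝ}
    (hb : b ∈ Icc 0 ℓ) (hsu : s * u ∈ Ico 0 ℓ) :
    ConeSquare.coneHt (cU v ℓ j) ℓ m ψ (spt v ℓ j s (b, u)) =
      ψ (ept v j b) + (m - ψ (ept v j b)) * (s * u) / ℓ := by
  have hne : stdPt ℓ (b, s * u) ≠ (ℓ, ℓ) := fun h ↦ by
    have := congrArg Prod.snd h; simp [stdPt] at this; linarith [hsu.2]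
  unfold spt cU
  rw [ConeSquare.coneHt_apply, radial_vadd_Rz, proj_vadd_Rz j hne, proj_stdPt_upper hℓ hb hsu,
    ConeSquare.radial_def, dist_stdPt_upper hℓ hb hsu, ept]
  field_simp
  ring

/-- **The cone height of the lower square along a broken ray**: for `-ℓ < s u ≤ 0` it is
`ψ(e_b) + (m - ψ(e_b)) (-(s u)) / ℓ`. [folklore] -/
theorem coneHt_spt_lower (hℓ : 0 < ℓ) (j : ZMod 4) {s : ℝ} (m : ℝ) (ψ : ℝ × ℝ → ℝ) {b u : ℝ}
    (hb : b ∈ Icc 0 ℓ) (hsu : s * u ∈ Ioc (-ℓ) 0) :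
    ConeSquare.coneHt (cL v ℓ j) ℓ m ψ (spt v ℓ j s (b, u)) =
      ψ (ept v j b) + (m - ψ (ept v j b)) * (-(s * u)) / ℓ := by
  have hne : stdPt ℓ (b, s * u) ≠ (ℓ, -ℓ) := fun h ↦ by
    have := congrArg Prod.snd h; simp [stdPt] at this; linarith [hsu.1]
  unfold spt cL
  rw [ConeSquare.coneHt_apply, radial_vadd_Rz, proj_vadd_Rz j hne, proj_stdPt_lower hℓ hb hsu,
    ConeSquare.radial_def, dist_stdPt_lower hℓ hb hsu, ept]
  field_simp
  ring

/-- Upper parametrised points lie in the upper square. [folklore] -/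
theorem spt_mem_closedBall_upper (hℓ : 0 < ℓ) (j : ZMod 4) {s b u : ℝ} (hb : b ∈ Icc 0 ℓ) (hsu : s * u ∈ Ico 0 ℓ) :
    spt v ℓ j s (b, u) ∈ closedBall (cU v ℓ j) ℓ := by
  unfold spt cU
  rw [mem_closedBall, dist_vadd_Rz, dist_stdPt_upper hℓ hb hsu]
  linarith [hsu.1]

/-- Lower parametrised points lie in the lower square. [folklore] -/
theorem spt_mem_closedBall_lower (hℓ : 0 < ℓ) (j : ZMod 4) {s b u : ℝ} (hb : b ∈ Icc 0 ℓ) (hsu : s * u ∈ Ioc (-ℓ) 0) :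
    spt v ℓ j s (b, u) ∈ closedBall (cL v ℓ j) ℓ := by
  unfold spt cL
  rw [mem_closedBall, dist_vadd_Rz, dist_stdPt_lower hℓ hb hsu]
  linarith [hsu.2]

/-- The distance of a parametrised point to `v` is at most `b + |u|`. [folklore] -/
theorem dist_spt_le (hℓ : 0 < ℓ) (j : ZMod 4) {s : ℝ} (hs : IsSg s) {b u : ℝ} (hb : b ∈ Icc 0 ℓ) :
    dist (spt v ℓ j s (b, u)) v ≤ b + |u| := by
  unfold spt
  rw [dist_eq_norm, add_sub_cancel_left, norm_Rz, Prod.norm_def, stdPt]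
  simp only [hs.abs_mul, Real.norm_eq_abs]
  refine max_le ?_ (by linarith [hb.1])
  have h1 : |u| * (ℓ - b) / ℓ ≤ |u| := by
    rw [div_le_iff₀ hℓ]; nlinarith [abs_nonneg u, hb.1]
  have h2 : 0 ≤ |u| * (ℓ - b) / ℓ := div_nonneg (mul_nonneg (abs_nonneg u) (by linarith [hb.2])) hℓ.le
  rw [abs_of_nonneg (by linarith [hb.1])]
  linarith

/-- The lower centre of the sector `j + 1` is the upper centre of the sector `j`. [folklore] -/
theorem cL_add_one (j : ZMod 4) : cL v ℓ (j + 1) = cU v ℓ j := by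
  unfold cL cU
  rw [Rz_add_one, R_Rz_comm, R_apply]
  simp

/-- The axis point `(0, u)` of the sector `j` with `0 ≤ s u` is a diagonal point of the upper
square: `v + Rz j (t, t)`, `t = s u`. [folklore] -/
theorem spt_axis_upper (hℓ : ℓ ≠ 0) (j : ZMod 4) {s u : ℝ} (hsu : 0 ≤ s * u) :
    spt v ℓ j s (0, u) = v + Rz j (s * u, s * u) := by
  unfold spt stdPt
  simp [abs_of_nonneg hsu, mul_div_cancel_right₀ _ hℓ]

/-- The axis point `(0, u)` of the sector `j` with `s u ≤ 0` is a diagonal point of the lower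
square: `v + Rz j (t, -t)`, `t = -(s u)`. [folklore] -/
theorem spt_axis_lower (hℓ : ℓ ≠ 0) (j : ZMod 4) {s u : ℝ} (hsu : s * u ≤ 0) :
    spt v ℓ j s (0, u) = v + Rz j (-(s * u), s * u) := by
  unfold spt stdPt
  simp [abs_of_nonpos hsu, mul_div_cancel_right₀ _ hℓ, neg_div]

/-- **The shared diagonal**: the axis point of the sector `j` on the upper side equals the axis
point of the sector `j + 1` on its lower side, at opposite signed ordinates. [folklore] -/
theorem spt_axis_succ (hℓ : ℓ ≠ 0) (j : ZMod 4) {s s' u u' : ℝ} (hsu : 0 ≤ s * u) (h : s' * u' = -(s * u)) :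
    spt v ℓ (j + 1) s' (0, u') = spt v ℓ j s (0, u) := by
  rw [spt_axis_upper hℓ j hsu, spt_axis_lower hℓ (j + 1) (by rw [h]; linarith), h, neg_neg, Rz_add_one,
    R_Rz_comm, R_apply]
  simp

end VertexSector

end Literature.Topology.FourManifolds
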